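import Literature.NumberTheory.LFunctions.KadiriExplicitTerms
import Literature.NumberTheory.LFunctions.KadiriMasterInequality3
import HarnessLib

/-!
# The master inequality with explicit terms, third-order far-zero remainder

Topic `Literature/NumberTheory/LFunctions`. Everything in this file is PROVED (no definition, no
named fact). Companion of `KadiriExplicitTerms.lean` (Kadiri, Acta Arith. 117 (2005), §§2–4,
(3.10); Mossinghoff–Trudgian 2015, §4): the pole terms at `k ≥ 1`, the terms at `k ≥ 1` and the
explicit master inequality (`KadiriExplicit3.abs_re_fordLaplace_pole_le`, `term_pos_le`,
`master_explicit`) restated with the third-order far-zero remainder of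
`KadiriThirdOrderRemainder.lean`: the hypothesis `M(x/η) ≤ M*` (`x ≥ σ − 1`) of the originals
becomes `M₃(x/η) η ≤ M* t₀`, and the pole terms are estimated at heights `|t| ≥ t₀` (so `t₀ ≤ T₀` is
assumed); the conclusions are verbatim those of `KadiriExplicitTerms.lean`, and so are the proofs
(the `k = 0` terms, `KadiriExplicit.term_zero_le`, do not involve the remainder bound and are used
as they stand).

## References

* H. Kadiri, *Une région explicite sans zéros pour la fonction ζ de Riemann*, Acta Arith. 117
  (2005) = arXiv:math/0401238, Props. 2.2–2.4, (3.10), Lemmas 3.2, 4.5, 4.7. [Kadiri2005]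
* M. J. Mossinghoff, T. S. Trudgian, J. Number Theory 157 (2015) = arXiv:1410.3926, (2.2), §4.
  [MossinghoffTrudgian2015]
-/

noncomputable section

open Complex Real MeasureTheory Set

namespace Literature.NumberTheory.LFunctions

namespace KadiriExplicit3

open NicolasJExplicit

variable {θ η : ℝ}

/-- **The pole terms at `k ≥ 1`, third-order remainder**: for `|x − 1| ≤ 1`, `|t| ≥ t₀ > 0` and
`M₃((x−1)/η) η ≤ M* t₀`, `|Re F(x − 1 + it)| ≤ (ηg₁ + M*η²)/t²`. [cite: Kadiri2005, Prop. 2.3] -/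
theorem abs_re_fordLaplace_pole_le (hθ : 0 < θ) (hθ' : θ < π / 2) (hη : 0 < η) {x t t₀ Mst : ℝ}
    (hx : |x - 1| ≤ 1) (ht₀ : 0 < t₀) (ht : t₀ ≤ |t|) (hM : mtyM3 θ ((x - 1) / η) * η ≤ Mst * t₀) :
    |(fordLaplace (kadiriTest θ η) ((x : ℂ) + (t : ℂ) * I - 1)).re| ≤
      (η * fordSmoothW0 θ + Mst * η ^ 2) / t ^ 2 := by
  have ht' : t ≠ 0 := abs_pos.1 (ht₀.trans_le ht)
  have e : (x : ℂ) + (t : ℂ) * I - 1 = ((x - 1 : ℝ) : ℂ) + (t : ℂ) * I := by push_cast; ring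
  rw [e]
  have hH := KadiriThird.abs_H_le hθ hθ' hη (x := x - 1) ht₀ ht hM
  have hg0 : 0 < fordSmoothW0 θ := fordSmoothW0_pos hθ hθ'
  have ht2 : 0 < t ^ 2 := by positivity
  have hq : 0 < (x - 1) ^ 2 + t ^ 2 := by positivity
  -- the main term `ηg₁(x−1)/((x−1)² + t²)` is at most `ηg₁/t²` in absolute value
  have hmain : |η * fordSmoothW0 θ * (x - 1) / ((x - 1) ^ 2 + t ^ 2)| ≤ η * fordSmoothW0 θ / t ^ 2 := by
    rw [abs_div, abs_of_pos hq, abs_mul, abs_of_pos (by positivity : 0 < η * fordSmoothW0 θ),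
      div_le_div_iff₀ hq ht2]
    have h1 : |x - 1| * t ^ 2 ≤ 1 * ((x - 1) ^ 2 + t ^ 2) := by nlinarith [abs_nonneg (x - 1), sq_abs (x - 1)]
    nlinarith [mul_le_mul_of_nonneg_left h1 (by positivity : 0 ≤ η * fordSmoothW0 θ)]
  have htri := abs_add_le ((fordLaplace (kadiriTest θ η) (((x - 1 : ℝ) : ℂ) + (t : ℂ) * I)).re -
      η * fordSmoothW0 θ * (x - 1) / ((x - 1) ^ 2 + t ^ 2))
    (η * fordSmoothW0 θ * (x - 1) / ((x - 1) ^ 2 + t ^ 2))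
  rw [sub_add_cancel] at htri
  rw [add_div]
  linarith

/-- **The terms of the master inequality at `k ≥ 1`, explicitly, third-order far-zero remainder** (`t = kγ₀ ≥ γ₀ ≥ T₀ ≥ 7`,
`log(kγ₀) = log k + log γ₀`). [cite: Kadiri2005, (3.10)] -/
theorem term_pos_le (hθ : 0 < θ) (hθ' : θ < π / 2) (hη : 0 < η) {σ₀ σ δ κ γ₀ t₀ T₀ Mst m αJ βJ : ℝ}
    (hσ₀ : 1 / 2 < σ₀) (hσ₀σ : σ₀ ≤ σ) (hσ1 : σ ≤ 1) (hδ : 0 ≤ δ) (hδ1 : δ < 1) (hκ0 : 0 ≤ κ)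
    (hκ1 : κ ≤ 1) (hκΓ : κ * (σ + 2 + δ) ≤ σ + 2) (hT₀ : 7 ≤ T₀) (hγ₀ : T₀ ≤ γ₀) (ht₀ : 1 ≤ t₀)
    (ht₀T : t₀ ≤ T₀)
    (hm : ∀ u ∈ Icc 0 (mtyD1 θ), |mtyH1Deriv2 1 θ u| ≤ m)
    (hM : ∀ x : ℝ, σ - 1 ≤ x → mtyM3 θ (x / η) * η ≤ Mst * t₀)
    (hJ : ∀ t : ℝ, T₀ ≤ t → (∫ y : ℝ, |(digamma (((((1 / 2 : ℝ)) : ℂ) + y * I) / 2)).re| /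
      ((σ₀ - 1 / 2) ^ 2 + (t - y) ^ 2)) ≤ αJ * Real.log t + βJ)
    {k : ℕ} (hk : 1 ≤ k) :
    kadiriTest θ η 0 * (kadiriT1 ((σ : ℂ) + (((k : ℝ) * γ₀ : ℝ) : ℂ) * I) -
        κ * kadiriT1 (((σ + δ : ℝ) : ℂ) + (((k : ℝ) * γ₀ : ℝ) : ℂ) * I)) +
      ((fordLaplace (kadiriTest θ η) ((σ : ℂ) + (((k : ℝ) * γ₀ : ℝ) : ℂ) * I - 1)).re -
        κ * (fordLaplace (kadiriTest θ η) (((σ + δ : ℝ) : ℂ) + (((k : ℝ) * γ₀ : ℝ) : ℂ) * I - 1)).re) +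
      (kadiriT2 (kadiriTest θ η) ((σ : ℂ) + (((k : ℝ) * γ₀ : ℝ) : ℂ) * I) -
        κ * kadiriT2 (kadiriTest θ η) (((σ + δ : ℝ) : ℂ) + (((k : ℝ) * γ₀ : ℝ) : ℂ) * I)) +
      (1 + κ) * Mst * η ^ 2 * (3 * KadiriTail.tailBound ((k : ℝ) * γ₀) t₀) ≤
    η * fordSmoothW0 θ * ((1 - κ) / 2 * (Real.log k + Real.log γ₀) - (1 - κ) / 2 * Real.log (2 * π) +
        5 / T₀ ^ 2) +
      (1 + κ) * (η * fordSmoothW0 θ + Mst * η ^ 2) / T₀ ^ 2 +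
      (1 + κ) * (m * η ^ 3) * (2 / T₀ ^ 2 + (αJ * (Real.log k + Real.log γ₀) + βJ) / (2 * π * (σ₀ - 1 / 2))) +
      (1 + κ) * Mst * η ^ 2 * (3 * ((154 + 30 * (Real.log k + Real.log γ₀ + 1)) * (1 / t₀ ^ 2 + 1 / t₀) +
        30 * (Real.log t₀ / t₀ ^ 2 + (Real.log t₀ + 1) / t₀))) := by
  have hg0 : 0 < fordSmoothW0 θ := fordSmoothW0_pos hθ hθ'
  have hf0 : kadiriTest θ η 0 = η * fordSmoothW0 θ := KadiriTest.map_zero hθ hθ'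
  have hm0 : 0 ≤ m := (abs_nonneg _).trans (hm 0 ⟨le_rfl, (KadiriTest.mtyD1_pos hθ hθ').le⟩)
  have hMst0 : 0 ≤ Mst := by
    have h1 : 0 ≤ Mst * t₀ := (mul_nonneg (KadiriThird.mtyM3_nonneg hθ hθ' _) hη.le).trans (hM σ (by linarith))
    exact (mul_nonneg_iff_of_pos_right (by linarith)).1 h1
  have hk1 : (1 : ℝ) ≤ k := by exact_mod_cast hk
  set t : ℝ := (k : ℝ) * γ₀ with htdef
  have hγ7 : 7 ≤ γ₀ := hT₀.trans hγ₀
  have htγ : γ₀ ≤ t := by rw [htdef]; nlinarith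
  have htT : T₀ ≤ t := hγ₀.trans htγ
  have ht7 : 7 ≤ t := hT₀.trans htT
  have ht0 : 0 < t := by linarith
  have hlogt : Real.log t = Real.log k + Real.log γ₀ := by
    rw [htdef, Real.log_mul (by positivity) (by linarith)]
  have ht2 : 1 / t ^ 2 ≤ 1 / T₀ ^ 2 := one_div_le_one_div_of_le (by positivity) (by nlinarith)
  refine add_le_add (add_le_add (add_le_add ?_ ?_) ?_) ?_
  · -- Γ-terms
    rw [hf0, ← hlogt]
    refine mul_le_mul_of_nonneg_left ?_ (by positivity)
    have h := KadiriExplicit.kadiriT1_sub_le (σ := σ) (δ := δ) (κ := κ) (t := t) (by linarith) hδ hκ0 hκΓ (by linarith)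
    have hr := KadiriExplicit.gammaErr_le (σ := σ) (κ := κ) (t := t) (T₀ := T₀) (by linarith) hσ1 hκ1 (by linarith) htT
    linarith
  · -- poles
    have htabs : t₀ ≤ |t| := by rw [abs_of_pos ht0]; linarith
    have h1 := abs_re_fordLaplace_pole_le hθ hθ' hη (x := σ) (t := t) (Mst := Mst)
      (by rw [abs_le]; constructor <;> linarith) (by linarith) htabs (hM (σ - 1) le_rfl)
    have h2 := abs_re_fordLaplace_pole_le hθ hθ' hη (x := σ + δ) (t := t) (Mst := Mst)
      (by rw [abs_le]; constructor <;> linarith) (by linarith) htabs (hM (σ + δ - 1) (by linarith))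
    have hb0 : 0 ≤ (η * fordSmoothW0 θ + Mst * η ^ 2) := by positivity
    have hbt : (η * fordSmoothW0 θ + Mst * η ^ 2) / t ^ 2 ≤ (η * fordSmoothW0 θ + Mst * η ^ 2) / T₀ ^ 2 := by
      rw [div_eq_mul_one_div, div_eq_mul_one_div _ (T₀ ^ 2)]
      exact mul_le_mul_of_nonneg_left ht2 hb0
    have hA := ((le_abs_self _).trans h1).trans hbt
    have hBκ := mul_le_mul_of_nonneg_left (((neg_le_abs _).trans h2).trans hbt) hκ0
    have e2 : (1 + κ) * (η * fordSmoothW0 θ + Mst * η ^ 2) / T₀ ^ 2 =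
        (η * fordSmoothW0 θ + Mst * η ^ 2) / T₀ ^ 2 + κ * ((η * fordSmoothW0 θ + Mst * η ^ 2) / T₀ ^ 2) := by
      ring
    rw [e2]
    linarith
  · -- Γ-remainders
    have ha₀ : 0 < σ₀ - 1 / 2 := by linarith
    have hJnn : ∀ {a : ℝ}, 0 ≤ ∫ y : ℝ, |(digamma (((((1 / 2 : ℝ)) : ℂ) + y * I) / 2)).re| /
        (a ^ 2 + (t - y) ^ 2) := fun {a} ↦ integral_nonneg fun y ↦ by positivity
    have hJt := hJ t htT
    have hJb0 : 0 ≤ αJ * Real.log t + βJ := hJnn.trans hJt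
    have key : ∀ {x : ℝ}, σ₀ ≤ x → x ≤ 2 →
        |kadiriT2 (kadiriTest θ η) ((x : ℂ) + (t : ℂ) * I)| ≤
          (m * η ^ 3) * (2 / T₀ ^ 2 + (αJ * Real.log t + βJ) / (2 * π * (σ₀ - 1 / 2))) := by
      intro x hx hx2
      have hx' : 1 / 2 < x := by linarith
      refine (KadiriExplicit.abs_kadiriT2_le hθ hθ' hη (x := x) (t := t) hx' hm).trans ?_
      have hx0 : 0 < x := by linarith
      have h2π : 0 < 2 * π := by positivity
      refine mul_le_mul_of_nonneg_left (add_le_add ?_ ?_) (by positivity)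
      · have hxt : 1 / 2 * t ^ 2 ≤ x * (x ^ 2 + t ^ 2) := by
          nlinarith [sq_nonneg x, mul_pos ht0 ht0, mul_nonneg hx0.le (sq_nonneg x)]
        calc 1 / (x * (x ^ 2 + t ^ 2)) ≤ 1 / (1 / 2 * t ^ 2) :=
              one_div_le_one_div_of_le (by positivity) hxt
          _ = 2 * (1 / t ^ 2) := by field_simp
          _ ≤ 2 * (1 / T₀ ^ 2) := by linarith
          _ = 2 / T₀ ^ 2 := by ring
      · have hJ1 := KadiriExplicit.J_antitone (t := t) ha₀ (by linarith : σ₀ - 1 / 2 ≤ x - 1 / 2)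
        have hJx := hJ1.trans hJt
        have hd1 : 0 < 2 * π * (x - 1 / 2) := mul_pos h2π (by linarith)
        have hd0 : 0 < 2 * π * (σ₀ - 1 / 2) := mul_pos h2π ha₀
        calc (∫ y : ℝ, |(digamma (((((1 / 2 : ℝ)) : ℂ) + y * I) / 2)).re| /
              ((x - 1 / 2) ^ 2 + (t - y) ^ 2)) / (2 * π * (x - 1 / 2))
            ≤ (αJ * Real.log t + βJ) / (2 * π * (x - 1 / 2)) := div_le_div_of_nonneg_right hJx hd1.le
          _ ≤ (αJ * Real.log t + βJ) / (2 * π * (σ₀ - 1 / 2)) :=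
              div_le_div_of_nonneg_left hJb0 hd0 (mul_le_mul_of_nonneg_left (by linarith) h2π.le)
    have h1 := (le_abs_self _).trans (key (x := σ) hσ₀σ (by linarith))
    have h2 := mul_le_mul_of_nonneg_left ((neg_le_abs _).trans (key (x := σ + δ) (by linarith) (by linarith)))
      hκ0
    rw [← hlogt]
    linarith [h1, h2]
  · -- tails
    have hB : KadiriTail.tailBound t t₀ ≤ (154 + 30 * (Real.log k + Real.log γ₀ + 1)) * (1 / t₀ ^ 2 + 1 / t₀) +
        30 * (Real.log t₀ / t₀ ^ 2 + (Real.log t₀ + 1) / t₀) := by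
      unfold KadiriTail.tailBound
      have hl := KadiriExplicit.log_add_seven_le ht7
      rw [hlogt] at hl
      have h0 : 0 ≤ 1 / t₀ ^ 2 + 1 / t₀ := by positivity
      have := mul_le_mul_of_nonneg_right
        (by linarith : 154 + 30 * Real.log (t + 7) ≤ 154 + 30 * (Real.log k + Real.log γ₀ + 1)) h0
      linarith
    have hc : 0 ≤ (1 + κ) * Mst * η ^ 2 := by positivity
    exact mul_le_mul_of_nonneg_left (mul_le_mul_of_nonneg_left hB (by norm_num)) hc

/-- **The explicit master inequality, third-order far-zero remainder** (Kadiri (3.10) /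
Mossinghoff–Trudgian (2.2) before dividing out; the statement of `KadiriExplicit.master_explicit`
with `M(x/η) ≤ M*` replaced by `M₃(x/η) η ≤ M* t₀`, `x ≥ σ − 1`, and `t₀ ≤ T₀`): for the zero `ρ₀ = β₀ + iγ₀` with `1 − η ≤ β₀ ≤ σ`, under the hypotheses of
`KadiriMaster.master_ineq` and the explicit bounds of this file,
`a₁[L((σ−1)/η + 1)·… ] ≤ a₀ · Bound₀ + Σ_{k=1}^{n} a_k · Bound_k` with `Bound₀`, `Bound_k` the
right-hand sides of `KadiriExplicit.term_zero_le`, `term_pos_le` (the `L`-values, `log k`, `log γ₀`, and the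
numerical inputs `M*`, `m`, `J₀`, `αJ`, `βJ`). [cite: Kadiri2005, (3.10)] -/
theorem master_explicit (hθ : 0 < θ) (hθ' : θ < π / 2) (hη : 0 < η)
    {σ₀ σ δ κ γ₀ t₀ T₀ Mst m J₀ αJ βJ : ℝ} {K : ℕ} {b : ℕ → ℝ} (hb : IsNonnegTrigPoly K b)
    (hK : 1 ≤ K) (hσ₀ : 1 / 2 < σ₀) (hσ₀σ : σ₀ ≤ σ) (hσ1 : σ < 1) (hδ : 0 ≤ δ) (hδ1 : δ < 1)
    (hδσ : 2 * (1 - σ) ≤ δ) (hκ0 : 0 ≤ κ) (hκ1 : κ ≤ 1) (hκΓ : κ * (σ + 2 + δ) ≤ σ + 2)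
    (hT₀ : 7 ≤ T₀) (hγ₀ : T₀ ≤ γ₀) (ht₀ : 4 ≤ t₀) (ht₀T : t₀ ≤ T₀)
    (hζ : ∀ k ≤ K, riemannZeta ((σ : ℂ) + (((k : ℝ) * γ₀ : ℝ) : ℂ) * I) ≠ 0)
    (hζ' : ∀ k ≤ K, riemannZeta (((σ + δ : ℝ) : ℂ) + (((k : ℝ) * γ₀ : ℝ) : ℂ) * I) ≠ 0)
    (hnear : ∀ k ≤ K, ∀ ρ : Zeros, |(ρ : ℂ).im - (k : ℝ) * γ₀| < t₀ →
      1 - σ ≤ (ρ : ℂ).re ∧ (ρ : ℂ).re ≤ σ)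
    (hB : ∀ y : ℝ, κ * ((fordLaplace (kadiriTest θ η) ((δ : ℂ) + y * I)).re +
        (fordLaplace (kadiriTest θ η) (((2 * σ - 1 + δ : ℝ) : ℂ) + y * I)).re) ≤
      (fordLaplace (kadiriTest θ η) (((0 : ℝ) : ℂ) + y * I)).re +
        (fordLaplace (kadiriTest θ η) (((2 * σ - 1 : ℝ) : ℂ) + y * I)).re)
    (hA : κ * (2 * σ - 1 + 2 * δ) ≤ 2 * σ - 1)
    (hSt : κ * (2 * σ - 1 + 2 * δ) * (-(1 - σ) + (2 * σ - 1) * δ + δ ^ 2 + t₀ ^ 2) ≤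
      (2 * σ - 1) * (-(1 - σ) + t₀ ^ 2))
    (hM : ∀ x : ℝ, σ - 1 ≤ x → mtyM3 θ (x / η) * η ≤ Mst * t₀)
    (hm : ∀ u ∈ Icc 0 (mtyD1 θ), |mtyH1Deriv2 1 θ u| ≤ m)
    (hJ0 : (∫ y : ℝ, |(digamma (((((1 / 2 : ℝ)) : ℂ) + y * I) / 2)).re| /
      ((σ₀ - 1 / 2) ^ 2 + (0 - y) ^ 2)) ≤ J₀)
    (hJ : ∀ t : ℝ, T₀ ≤ t → (∫ y : ℝ, |(digamma (((((1 / 2 : ℝ)) : ℂ) + y * I) / 2)).re| /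
      ((σ₀ - 1 / 2) ^ 2 + (t - y) ^ 2)) ≤ αJ * Real.log t + βJ)
    (ρ₀ : Zeros) (hρ₀ : (ρ₀ : ℂ).im = γ₀) (hβlow : 1 - η ≤ (ρ₀ : ℂ).re) (hβσ : (ρ₀ : ℂ).re ≤ σ)
    (hη2 : η < 1 / 2) :
    b 1 * (mtyLaplace θ ((σ - (1 - η)) / η) + mtyLaplace θ (1 / η) -
        κ * (mtyLaplace θ (δ / η) + mtyLaplace θ ((σ + δ - 1 + (1 - η)) / η))) ≤
      b 0 * (η * fordSmoothW0 θ * (-((1 - κ) / 2) * Real.log π + (digamma ((3 / 2 : ℝ) : ℂ)).re / 2 -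
            κ / 2 * (digamma ((((σ₀ + δ) / 2 + 1 : ℝ)) : ℂ)).re) +
          (mtyLaplace θ ((σ - 1) / η) - κ * mtyLaplace θ ((σ + δ - 1) / η)) +
          (1 + κ) * (m * η ^ 3) * (1 / σ₀ ^ 3 + J₀ / (2 * π * (σ₀ - 1 / 2))) +
          (1 + κ) * Mst * η ^ 2 * (3 * KadiriTail.tailBound 0 t₀)) +
      ∑ k ∈ Finset.range K, b (k + 1) *
        (η * fordSmoothW0 θ * ((1 - κ) / 2 * (Real.log ((k + 1 : ℕ) : ℝ) + Real.log γ₀) -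
            (1 - κ) / 2 * Real.log (2 * π) + 5 / T₀ ^ 2) +
          (1 + κ) * (η * fordSmoothW0 θ + Mst * η ^ 2) / T₀ ^ 2 +
          (1 + κ) * (m * η ^ 3) * (2 / T₀ ^ 2 +
            (αJ * (Real.log ((k + 1 : ℕ) : ℝ) + Real.log γ₀) + βJ) / (2 * π * (σ₀ - 1 / 2))) +
          (1 + κ) * Mst * η ^ 2 * (3 * ((154 + 30 * (Real.log ((k + 1 : ℕ) : ℝ) + Real.log γ₀ + 1)) *
            (1 / t₀ ^ 2 + 1 / t₀) + 30 * (Real.log t₀ / t₀ ^ 2 + (Real.log t₀ + 1) / t₀)))) := by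
  have hb0 : ∀ k, 0 ≤ b k := hb.1
  have hσ : 1 / 2 < σ := by linarith
  have hβ₀ : 1 / 2 < (ρ₀ : ℂ).re := by linarith
  have hρ₀' : |(ρ₀ : ℂ).im - γ₀| < t₀ := by rw [hρ₀, sub_self, abs_zero]; linarith
  have hmaster := KadiriMaster3.master_ineq hθ hθ' hη hb hK hσ hσ1 hδ hδ1 hδσ hκ0 hκ1
    (by linarith) ht₀ hζ hζ' hnear hB hA hSt hM ρ₀ hρ₀' hβ₀
  rw [Finset.sum_range_succ'] at hmaster
  -- the kept pair
  have hpair := KadiriExplicit.pairVal_self_ge hθ hθ' hη (σ := σ) (δ := δ) (κ := κ) (t := γ₀) (β := (ρ₀ : ℂ).re)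
    (βlow := 1 - η) hβlow hβσ (by linarith) hσ1.le hκ0
  rw [← hρ₀] at hpair
  have hρ₀im : (ρ₀ : ℂ).im = γ₀ := hρ₀
  rw [hρ₀im] at hpair
  have hL : b 1 * (mtyLaplace θ ((σ - (1 - η)) / η) + mtyLaplace θ (1 / η) -
      κ * (mtyLaplace θ (δ / η) + mtyLaplace θ ((σ + δ - 1 + (1 - η)) / η))) ≤
      b 1 * KadiriZeroSum.pairVal θ η σ δ κ γ₀ (ρ₀ : ℂ).re γ₀ :=
    mul_le_mul_of_nonneg_left hpair (hb0 1)
  -- the `k = 0` term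
  have h0 := mul_le_mul_of_nonneg_left (KadiriExplicit.term_zero_le hθ hθ' hη (γ₀ := γ₀) (t₀ := t₀) (Mst := Mst)
    hσ₀ hσ₀σ hσ1.le hδ hδ1.le hκ0 hm hJ0) (hb0 0)
  -- the `k ≥ 1` terms
  have hpos : ∑ k ∈ Finset.range K, b (k + 1) *
      (kadiriTest θ η 0 * (kadiriT1 ((σ : ℂ) + ((((k + 1 : ℕ) : ℝ) * γ₀ : ℝ) : ℂ) * I) -
          κ * kadiriT1 (((σ + δ : ℝ) : ℂ) + ((((k + 1 : ℕ) : ℝ) * γ₀ : ℝ) : ℂ) * I)) +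
        ((fordLaplace (kadiriTest θ η) ((σ : ℂ) + ((((k + 1 : ℕ) : ℝ) * γ₀ : ℝ) : ℂ) * I - 1)).re -
          κ * (fordLaplace (kadiriTest θ η)
            (((σ + δ : ℝ) : ℂ) + ((((k + 1 : ℕ) : ℝ) * γ₀ : ℝ) : ℂ) * I - 1)).re) +
        (kadiriT2 (kadiriTest θ η) ((σ : ℂ) + ((((k + 1 : ℕ) : ℝ) * γ₀ : ℝ) : ℂ) * I) -
          κ * kadiriT2 (kadiriTest θ η) (((σ + δ : ℝ) : ℂ) + ((((k + 1 : ℕ) : ℝ) * γ₀ : ℝ) : ℂ) * I)) +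
        (1 + κ) * Mst * η ^ 2 * (3 * KadiriTail.tailBound (((k + 1 : ℕ) : ℝ) * γ₀) t₀)) ≤
      ∑ k ∈ Finset.range K, b (k + 1) *
        (η * fordSmoothW0 θ * ((1 - κ) / 2 * (Real.log ((k + 1 : ℕ) : ℝ) + Real.log γ₀) -
            (1 - κ) / 2 * Real.log (2 * π) + 5 / T₀ ^ 2) +
          (1 + κ) * (η * fordSmoothW0 θ + Mst * η ^ 2) / T₀ ^ 2 +
          (1 + κ) * (m * η ^ 3) * (2 / T₀ ^ 2 +
            (αJ * (Real.log ((k + 1 : ℕ) : ℝ) + Real.log γ₀) + βJ) / (2 * π * (σ₀ - 1 / 2))) +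
          (1 + κ) * Mst * η ^ 2 * (3 * ((154 + 30 * (Real.log ((k + 1 : ℕ) : ℝ) + Real.log γ₀ + 1)) *
            (1 / t₀ ^ 2 + 1 / t₀) + 30 * (Real.log t₀ / t₀ ^ 2 + (Real.log t₀ + 1) / t₀)))) := by
    refine Finset.sum_le_sum fun k _ ↦ mul_le_mul_of_nonneg_left ?_ (hb0 (k + 1))
    exact term_pos_le hθ hθ' hη hσ₀ hσ₀σ hσ1.le hδ hδ1 hκ0 hκ1 hκΓ hT₀ hγ₀ (by linarith) ht₀T hm hM hJ
      (k := k + 1) (by omega)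
  have hγim : KadiriZeroSum.pairVal θ η σ δ κ γ₀ (ρ₀ : ℂ).re (ρ₀ : ℂ).im =
      KadiriZeroSum.pairVal θ η σ δ κ γ₀ (ρ₀ : ℂ).re γ₀ := by rw [hρ₀im]
  rw [hγim] at hmaster
  have hfin := hL.trans (hmaster.trans (add_le_add hpos h0))
  exact hfin.trans_eq (add_comm _ _)

end KadiriExplicit3

end Literature.NumberTheory.LFunctions
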